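import Literature.NumberTheory.QuadraticForms.IntegralFramesOdd
import HarnessLib

/-!
# `2`-adic block frames of an even integral quadratic form with odd determinant

Topic `NumberTheory/QuadraticForms`; namespace `Literature.NumberTheory.QuadraticForms`. Everything
here is proved.

Let `G` be a symmetric integer matrix of size `n` with odd determinant whose form
`B(x, y) = ᵗx G y` on `ℤⁿ` is *even* (`B(x, x) ∈ 2ℤ`). The classical `2`-adic Jordan splitting says
that the unimodular quadratic `ℤ₂`-lattice `ℤ₂ⁿ` is an orthogonal sum of binary lattices
`(2a b; b 2c)` with `b` odd (Serre, *A Course in Arithmetic*, Ch. V §1.3.6: "splitting `E ⊗ ℤ₂`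
in an orthogonal direct sum of `ℤ₂`-modules of rank 1 or 2" — rank `2` only, the form being even;
Cassels, *Rational Quadratic Forms*, Ch. 8 §4). We prove its integral shadow inside `ℤⁿ`
(denominators cleared, no `2`-adic numbers):

* `exists_blockFamily`: for `2r ≤ n + 1` there are integer vectors `e₁, f₁, …, e_r, f_r`, the
  planes `⟨e_k, f_k⟩` pairwise orthogonal, with `B(e_k, f_k)` odd. Extension step
  (`exists_block_extension`): the integral projection `π` away from the blocks (built from the
  adjugates of the block Gram matrices, whose determinants `Δ_k = α_kγ_k - β_k²` are odd) satisfies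
  `B(πx, πy) = Δ Φ(x, y)`; if all `Φ(δ_a, δ_b)` were even, then modulo `2` the invertible matrix
  `G` would equal `∑_k (w_k ᵗu_k + u_k ᵗw_k)`, of rank `≤ 2r < n`.
* `exists_twoAdicFrame`: consequently `n = m + m` is even and there is an orthogonal family
  `v₁, …, v_m, w₁, …, w_m` of integer vectors with `B(v_k,v_k) = 2A_k`, `A_k` odd, and
  `B(w_k,w_k) = -2A_kD_k`, `D_k ≡ 1 (mod 4)` (`D_k = b_k² - 4a_kc_k` the negative of a block
  determinant): inside each block, after arranging `a` odd, take `v = e`, `w = 2a f - b e`.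

These frames feed the computation of `ε₂` of an even unimodular lattice (Serre, Ch. V §1.3.6,
§2.1 Remark 2).

## References

* J.-P. Serre, *A Course in Arithmetic*, GTM 7, Springer 1973, Ch. V §1.3.6 (PDF p. 46).
  [Serre1973]
* J. W. S. Cassels, *Rational Quadratic Forms*, Academic Press 1978, Ch. 8 §4 (`2`-adic Jordan
  decompositions).
-/

namespace Literature.NumberTheory.QuadraticForms

open Finset Matrix

/-! ### One more binary block -/

/-- **Extension step** (`p = 2`, even form, odd determinant). Given `r` pairwise orthogonal
binary blocks `⟨e_k, f_k⟩` of integer vectors with `B(e_k, f_k)` odd and `2r < n`, there are two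
more integer vectors `z, z'`, orthogonal to all blocks, with `B(z, z')` odd: the orthogonal
complement of unimodular binary `ℤ₍₂₎`-lattices in a unimodular lattice is unimodular, and an
even unimodular `ℤ₍₂₎`-lattice of positive rank contains `z, z'` with `z.z'` a unit (Serre,
Ch. V §1.3.6; Cassels, *Rational Quadratic Forms*, Ch. 8 Lemma 4.1) — here via the integral
block projection and a rank count modulo `2`. [cite: Serre1973, Ch. V §1.3.6] -/
theorem exists_block_extension {n : ℕ} {G : Matrix (Fin n) (Fin n) ℤ} (hG : G.IsSymm)
    (hdet : ¬ (2 : ℤ) ∣ G.det) (hev : ∀ x, Even (Matrix.toBilin' G x x)) {r : ℕ} (hr : 2 * r < n)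
    (e f : Fin r → (Fin n → ℤ))
    (hee : ∀ k l, k ≠ l → Matrix.toBilin' G (e k) (e l) = 0)
    (hef : ∀ k l, k ≠ l → Matrix.toBilin' G (e k) (f l) = 0)
    (hff : ∀ k l, k ≠ l → Matrix.toBilin' G (f k) (f l) = 0)
    (hodd : ∀ k, ¬ (2 : ℤ) ∣ Matrix.toBilin' G (e k) (f k)) :
    ∃ z z' : Fin n → ℤ, (∀ k, Matrix.toBilin' G z (e k) = 0 ∧ Matrix.toBilin' G z (f k) = 0 ∧
      Matrix.toBilin' G z' (e k) = 0 ∧ Matrix.toBilin' G z' (f k) = 0) ∧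
      ¬ (2 : ℤ) ∣ Matrix.toBilin' G z z' := by
  haveI : Fact (Nat.Prime 2) := ⟨Nat.prime_two⟩
  have h2p : Prime (2 : ℤ) := Int.prime_two
  set B := Matrix.toBilin' G with hB
  have hBs : B.IsSymm := Matrix.isSymm_toBilin'_iff_isSymm.mpr hG
  have hfe : ∀ k l, k ≠ l → B (f k) (e l) = 0 := fun k l hkl => by rw [hBs.eq]; exact hef l k hkl.symm
  -- block Gram entries
  set α : Fin r → ℤ := fun k => B (e k) (e k) with hα
  set β : Fin r → ℤ := fun k => B (e k) (f k) with hβ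
  set γ : Fin r → ℤ := fun k => B (f k) (f k) with hγ
  have hβ' : ∀ k, B (f k) (e k) = β k := fun k => by rw [hBs.eq]
  have hΔodd : ∀ k, ¬ (2 : ℤ) ∣ α k * γ k - β k ^ 2 := by
    intro k h
    have hαe : (2 : ℤ) ∣ α k * γ k := (even_iff_two_dvd.mp (hev (e k))).mul_right _
    have : (2 : ℤ) ∣ β k ^ 2 := by simpa using dvd_sub hαe h
    exact hodd k (h2p.dvd_of_dvd_pow this)
  -- `Δ = ∏ Δ_k`, `Δ'_k = ∏_{j ≠ k} Δ_j` (opaque)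
  obtain ⟨Δ, Δ', hΔ'Δ, hΔ2⟩ : ∃ (Δ : ℤ) (Δ' : Fin r → ℤ),
      (∀ k, Δ' k * (α k * γ k - β k ^ 2) = Δ) ∧ ¬ (2 : ℤ) ∣ Δ := by
    refine ⟨∏ k, (α k * γ k - β k ^ 2), fun k => ∏ j ∈ univ.erase k, (α j * γ j - β j ^ 2),
      fun k => Finset.prod_erase_mul _ _ (mem_univ k), fun h => ?_⟩
    obtain ⟨k, -, hk⟩ := h2p.exists_mem_finset_dvd h
    exact hΔodd k hk
  -- block corrections and the integral projection (opaque, with formulas)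
  obtain ⟨corr, hcorr⟩ : ∃ corr : Fin r → (Fin n → ℤ) → (Fin n → ℤ), ∀ k x, corr k x =
      (γ k * B x (e k) - β k * B x (f k)) • e k + (α k * B x (f k) - β k * B x (e k)) • f k :=
    ⟨_, fun k x => rfl⟩
  have hcorr_left : ∀ k x y, B (corr k x) y = (γ k * B x (e k) - β k * B x (f k)) * B (e k) y +
      (α k * B x (f k) - β k * B x (e k)) * B (f k) y := by
    intro k x y
    rw [hcorr]
    simp only [map_add, map_smul, LinearMap.add_apply, LinearMap.smul_apply, smul_eq_mul]
  have hcorr_e : ∀ k x, B (corr k x) (e k) = (α k * γ k - β k ^ 2) * B x (e k) := by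
    intro k x; rw [hcorr_left, hβ']; simp only [hα]; ring
  have hcorr_f : ∀ k x, B (corr k x) (f k) = (α k * γ k - β k ^ 2) * B x (f k) := by
    intro k x; rw [hcorr_left]; simp only [hβ, hγ]; ring
  have hcorr_e' : ∀ j k x, j ≠ k → B (corr j x) (e k) = 0 := by
    intro j k x hjk; rw [hcorr_left, hee j k hjk, hfe j k hjk, mul_zero, mul_zero, add_zero]
  have hcorr_f' : ∀ j k x, j ≠ k → B (corr j x) (f k) = 0 := by
    intro j k x hjk; rw [hcorr_left, hef j k hjk, hff j k hjk, mul_zero, mul_zero, add_zero]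
  obtain ⟨π, hπ⟩ : ∃ π : (Fin n → ℤ) → (Fin n → ℤ),
      ∀ x, π x = Δ • x - ∑ k, Δ' k • corr k x := ⟨_, fun x => rfl⟩
  have hπ_left : ∀ x y, B (π x) y = Δ * B x y - ∑ k, Δ' k * B (corr k x) y := by
    intro x y
    rw [hπ x]
    simp only [map_sub, map_smul, map_sum, LinearMap.sub_apply, LinearMap.smul_apply,
      LinearMap.sum_apply, smul_eq_mul]
  have hπ_e : ∀ x k, B (π x) (e k) = 0 := by
    intro x k
    rw [hπ_left, Finset.sum_eq_single k (fun j _ hjk => by rw [hcorr_e' j k x hjk, mul_zero])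
      (fun h => absurd (mem_univ k) h), hcorr_e, ← mul_assoc, hΔ'Δ k, sub_self]
  have hπ_f : ∀ x k, B (π x) (f k) = 0 := by
    intro x k
    rw [hπ_left, Finset.sum_eq_single k (fun j _ hjk => by rw [hcorr_f' j k x hjk, mul_zero])
      (fun h => absurd (mem_univ k) h), hcorr_f, ← mul_assoc, hΔ'Δ k, sub_self]
  have hΦ : ∀ x y, B (π x) (π y) = Δ * B (π x) y := by
    intro x y
    conv_lhs => rw [hπ y]
    rw [map_sub, map_smul, map_sum, smul_eq_mul]
    have : ∀ k, B (π x) (corr k y) = 0 := fun k => by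
      rw [hcorr]
      simp only [map_add, map_smul, smul_eq_mul, hπ_e, hπ_f, mul_zero, add_zero]
    simp only [map_smul, smul_eq_mul, this, mul_zero, Finset.sum_const_zero, sub_zero]
  -- pairing with coordinate vectors
  have hBsingle_e : ∀ a k, B (Pi.single a 1) (e k) = (G *ᵥ e k) a := fun a k => by
    rw [hB, Matrix.toBilin'_apply', single_dotProduct, one_mul]
  have hBsingle_f : ∀ a k, B (Pi.single a 1) (f k) = (G *ᵥ f k) a := fun a k => by
    rw [hB, Matrix.toBilin'_apply', single_dotProduct, one_mul]
  have hBsingle_e' : ∀ k b, B (e k) (Pi.single b 1) = (G *ᵥ e k) b := fun k b => by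
    rw [hBs.eq, hBsingle_e]
  have hBsingle_f' : ∀ k b, B (f k) (Pi.single b 1) = (G *ᵥ f k) b := fun k b => by
    rw [hBs.eq, hBsingle_f]
  have hBss : ∀ a b, B (Pi.single a 1) (Pi.single b 1) = G a b := Matrix.toBilin'_single G
  refine Classical.by_contradiction fun hall => ?_
  push Not at hall
  -- Step 1: every `Φ(δ_a, δ_b)` is even
  have hdiv : ∀ a b, (2 : ℤ) ∣ Δ * G a b - ∑ k, Δ' k *
      ((γ k * (G *ᵥ e k) a - β k * (G *ᵥ f k) a) * (G *ᵥ e k) b +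
        (α k * (G *ᵥ f k) a - β k * (G *ᵥ e k) a) * (G *ᵥ f k) b) := by
    intro a b
    refine Classical.by_contradiction fun hab => ?_
    have hXY : ¬ (2 : ℤ) ∣ B (π (Pi.single a 1)) (π (Pi.single b 1)) := by
      rw [hΦ, hπ_left]
      simp only [hcorr_left, hBsingle_e, hBsingle_f, hBsingle_e', hBsingle_f', hBss]
      exact fun h => (h2p.dvd_or_dvd h).elim hΔ2 hab
    exact hXY (hall _ _ fun k => ⟨hπ_e _ k, hπ_f _ k, hπ_e _ k, hπ_f _ k⟩)
  -- Step 2: modulo `2`, `G` would be a sum of `2r < n` matrices of rank `≤ 1`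
  obtain ⟨u, hu⟩ : ∃ u : Fin r → Fin n → ZMod 2, ∀ k a, u k a = (((G *ᵥ e k) a : ℤ) : ZMod 2) :=
    ⟨_, fun k a => rfl⟩
  obtain ⟨w, hw⟩ : ∃ w : Fin r → Fin n → ZMod 2, ∀ k a, w k a = (((G *ᵥ f k) a : ℤ) : ZMod 2) :=
    ⟨_, fun k a => rfl⟩
  have h1c : ∀ {x : ℤ}, ¬ (2 : ℤ) ∣ x → (x : ZMod 2) = 1 := fun hx =>
    (Int.not_even_iff_odd.mp fun he => hx (even_iff_two_dvd.mp he)).intCast_zmod_two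
  have hαc : ∀ k, (α k : ZMod 2) = 0 := fun k => (hev (e k)).intCast_zmod_two
  have hγc : ∀ k, (γ k : ZMod 2) = 0 := fun k => (hev (f k)).intCast_zmod_two
  have hβc : ∀ k, (β k : ZMod 2) = 1 := fun k => h1c (hodd k)
  have hΔc : (Δ : ZMod 2) = 1 := h1c hΔ2
  have hΔ'c : ∀ k, (Δ' k : ZMod 2) = 1 := fun k => h1c fun h =>
    hΔ2 (by rw [← hΔ'Δ k]; exact h.mul_right _)
  have hmat : (1 : ZMod 2) • G.map (Int.castRingHom (ZMod 2)) =
      ∑ k, (Matrix.vecMulVec (w k) (u k) + Matrix.vecMulVec (u k) (w k)) := by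
    ext a b
    have h := (ZMod.intCast_zmod_eq_zero_iff_dvd _ 2).mpr (hdiv a b)
    push_cast at h
    simp only [hαc, hγc, hβc, hΔc, hΔ'c, zero_mul, zero_sub, one_mul, neg_mul,
      ← hu, ← hw] at h
    -- `h : G a b - ∑ (-(w a * u b) + -(u a * w b)) = 0`
    simp only [Matrix.smul_apply, Matrix.map_apply, eq_intCast, Matrix.sum_apply, Matrix.add_apply,
      Matrix.vecMulVec_apply, one_smul]
    rw [eq_of_sub_eq_zero h]
    exact sum_congr rfl fun k _ => by rw [ZMod.neg_eq_self_mod_two, ZMod.neg_eq_self_mod_two]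
  have hrank := rank_smul_map_eq_of_not_dvd_det (p := 2) hdet (D := 1) (by norm_num)
  rw [Int.cast_one, hmat] at hrank
  have hle : (∑ k, (Matrix.vecMulVec (w k) (u k) + Matrix.vecMulVec (u k) (w k))).rank ≤ 2 * r :=
    calc (∑ k, (Matrix.vecMulVec (w k) (u k) + Matrix.vecMulVec (u k) (w k))).rank
        ≤ ∑ k, (Matrix.vecMulVec (w k) (u k) + Matrix.vecMulVec (u k) (w k)).rank :=
          matrixRank_sum_le _ _
      _ ≤ ∑ _k : Fin r, 2 := sum_le_sum fun k _ =>
          (matrixRank_add_le _ _).trans (Nat.add_le_add (Matrix.rank_vecMulVec_le _ _)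
            (Matrix.rank_vecMulVec_le _ _))
      _ = 2 * r := by simp [mul_comm]
  exact lt_irrefl _ ((hle.trans_lt hr).trans_eq hrank.symm)

/-- **Block families** (`p = 2`): for an even form `ᵗx G y` with odd determinant and every `r` with
`2r ≤ n + 1`, there are `r` pairwise orthogonal binary blocks `⟨e_k, f_k⟩` of integer vectors with
`B(e_k, f_k)` odd (iterate `exists_block_extension`). [cite: Serre1973, Ch. V §1.3.6] -/
theorem exists_blockFamily {n : ℕ} {G : Matrix (Fin n) (Fin n) ℤ} (hG : G.IsSymm)
    (hdet : ¬ (2 : ℤ) ∣ G.det) (hev : ∀ x, Even (Matrix.toBilin' G x x)) :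
    ∀ r, 2 * r ≤ n + 1 → ∃ e f : Fin r → (Fin n → ℤ),
      (∀ k l, k ≠ l → Matrix.toBilin' G (e k) (e l) = 0) ∧
      (∀ k l, k ≠ l → Matrix.toBilin' G (e k) (f l) = 0) ∧
      (∀ k l, k ≠ l → Matrix.toBilin' G (f k) (f l) = 0) ∧
      ∀ k, ¬ (2 : ℤ) ∣ Matrix.toBilin' G (e k) (f k) := by
  have hBs : (Matrix.toBilin' G).IsSymm := Matrix.isSymm_toBilin'_iff_isSymm.mpr hG
  intro r
  induction r with
  | zero => exact fun _ => ⟨Fin.elim0, Fin.elim0, fun k => k.elim0, fun k => k.elim0,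
      fun k => k.elim0, fun k => k.elim0⟩
  | succ r ih =>
    intro hr
    obtain ⟨e, f, hee, hef, hff, hodd⟩ := ih (by omega)
    obtain ⟨z, z', hz, hzz'⟩ := exists_block_extension hG hdet hev (by omega) e f hee hef hff hodd
    refine ⟨Fin.cons z e, Fin.cons z' f, fun k l hkl => ?_, fun k l hkl => ?_, fun k l hkl => ?_,
      fun k => ?_⟩
    · induction k using Fin.cases with
      | zero =>
        induction l using Fin.cases with
        | zero => exact absurd rfl hkl
        | succ l => simp only [Fin.cons_zero, Fin.cons_succ]; exact (hz l).1
      | succ k =>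
        induction l using Fin.cases with
        | zero => simp only [Fin.cons_zero, Fin.cons_succ]; rw [hBs.eq]; exact (hz k).1
        | succ l => simp only [Fin.cons_succ]; exact hee k l fun h => hkl (congrArg Fin.succ h)
    · induction k using Fin.cases with
      | zero =>
        induction l using Fin.cases with
        | zero => exact absurd rfl hkl
        | succ l => simp only [Fin.cons_zero, Fin.cons_succ]; exact (hz l).2.1
      | succ k =>
        induction l using Fin.cases with
        | zero => simp only [Fin.cons_zero, Fin.cons_succ]; rw [hBs.eq]; exact (hz k).2.2.1
        | succ l => simp only [Fin.cons_succ]; exact hef k l fun h => hkl (congrArg Fin.succ h)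
    · induction k using Fin.cases with
      | zero =>
        induction l using Fin.cases with
        | zero => exact absurd rfl hkl
        | succ l => simp only [Fin.cons_zero, Fin.cons_succ]; exact (hz l).2.2.2
      | succ k =>
        induction l using Fin.cases with
        | zero => simp only [Fin.cons_zero, Fin.cons_succ]; rw [hBs.eq]; exact (hz k).2.2.2
        | succ l => simp only [Fin.cons_succ]; exact hff k l fun h => hkl (congrArg Fin.succ h)
    · induction k using Fin.cases with
      | zero => simpa only [Fin.cons_zero] using hzz'
      | succ k => simpa only [Fin.cons_succ] using hodd k


/-! ### Orthogonal families are linearly independent; the rank is even -/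

/-- Pairwise orthogonal integer vectors of nonzero square are linearly independent over `ℤ`
(pair a vanishing combination with each vector). [folklore] -/
theorem linearIndependent_of_orthogonal {n : ℕ} (G : Matrix (Fin n) (Fin n) ℤ) {ι : Type*}
    (v : ι → (Fin n → ℤ)) (ho : ∀ i j, i ≠ j → Matrix.toBilin' G (v i) (v j) = 0)
    (hn : ∀ i, Matrix.toBilin' G (v i) (v i) ≠ 0) : LinearIndependent ℤ v := by
  classical
  rw [linearIndependent_iff']
  intro s c hc i hi
  have h := congrArg (fun x => Matrix.toBilin' G x (v i)) hc
  simp only [map_sum, map_smul, LinearMap.sum_apply, LinearMap.smul_apply, smul_eq_mul, map_zero,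
    LinearMap.zero_apply] at h
  rw [Finset.sum_eq_single i (fun j _ hji => by rw [ho j i hji, mul_zero]) (fun h' => absurd hi h')]
    at h
  exact (mul_eq_zero.mp h).resolve_right (hn i)

/-- Hence at most `n` pairwise orthogonal integer vectors of nonzero square exist in `ℤⁿ`.
[folklore] -/
theorem card_le_of_orthogonal {n : ℕ} (G : Matrix (Fin n) (Fin n) ℤ) {ι : Type*} [Fintype ι]
    (v : ι → (Fin n → ℤ)) (ho : ∀ i j, i ≠ j → Matrix.toBilin' G (v i) (v j) = 0)
    (hn : ∀ i, Matrix.toBilin' G (v i) (v i) ≠ 0) : Fintype.card ι ≤ n := by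
  simpa using (linearIndependent_of_orthogonal G v ho hn).fintype_card_le_finrank

/-! ### From blocks to orthogonal pairs `(v, w)` with squares `2A`, `-2AD` -/

/-- **Inside one block.** Given integer vectors `e, f` with `B(e,e), B(f,f)` even and `B(e,f)` odd
(for the even form `B = ᵗx G y`), there are `ℤ`-combinations `v, w` of `e, f` with
`B(v,w) = 0`, `B(v,v) = 2A`, `A` odd, `B(w,w) = -2AD`, `D ≡ 1 (mod 4)`: first arrange the block
basis `(g₁, g₂)` with `g₁.g₁ = 2a`, `a` odd (`g₁ ∈ {e, f, e + f}`), then `v = g₁`,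
`w = 2a g₂ - b g₁` with `b = g₁.g₂` odd, `D = b² - 4ac`. This is the passage from a `2`-adic
block `(2a b; b 2c)` to the diagonal form `⟨2a, -2aD⟩` over `ℚ`. [cite: Serre1973, Ch. V §1.3.6] -/
theorem exists_pair_of_block {n : ℕ} {G : Matrix (Fin n) (Fin n) ℤ} (hG : G.IsSymm)
    (hev : ∀ x, Even (Matrix.toBilin' G x x)) (e f : Fin n → ℤ)
    (hodd : ¬ (2 : ℤ) ∣ Matrix.toBilin' G e f) :
    ∃ (v w : Fin n → ℤ) (A D : ℤ), (∃ c₁ c₂ c₃ c₄ : ℤ, v = c₁ • e + c₂ • f ∧ w = c₃ • e + c₄ • f) ∧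
      Matrix.toBilin' G v w = 0 ∧ Matrix.toBilin' G v v = 2 * A ∧
      Matrix.toBilin' G w w = -(2 * A * D) ∧ ¬ (2 : ℤ) ∣ A ∧ ∃ t, D = 4 * t + 1 := by
  set B := Matrix.toBilin' G with hB
  have hBs : B.IsSymm := Matrix.isSymm_toBilin'_iff_isSymm.mpr hG
  -- Step 1: a block basis `(g₁, g₂)` with `g₁.g₁ = 2a`, `a` odd, `g₁.g₂` odd
  obtain ⟨g₁, g₂, a, hg, hg₁, ha, hb⟩ : ∃ (g₁ g₂ : Fin n → ℤ) (a : ℤ),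
      (∃ c₁ c₂ c₃ c₄ : ℤ, g₁ = c₁ • e + c₂ • f ∧ g₂ = c₃ • e + c₄ • f) ∧
      B g₁ g₁ = 2 * a ∧ ¬ (2 : ℤ) ∣ a ∧ ¬ (2 : ℤ) ∣ B g₁ g₂ := by
    obtain ⟨a', ha'⟩ := hev e
    obtain ⟨c', hc'⟩ := hev f
    by_cases ha : (2 : ℤ) ∣ a'
    · by_cases hc : (2 : ℤ) ∣ c'
      · -- both even: `g₁ = e + f`
        refine ⟨e + f, f, a' + B e f + c', ⟨1, 1, 0, 1, by simp, by simp⟩, ?_, ?_, ?_⟩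
        · simp only [map_add, LinearMap.add_apply]
          rw [hBs.eq f e, show B e e = a' + a' from ha', show B f f = c' + c' from hc']
          ring
        · intro h
          have h' : (2 : ℤ) ∣ a' + B e f + c' - a' - c' := dvd_sub (dvd_sub h ha) hc
          rw [show a' + B e f + c' - a' - c' = B e f by ring] at h'
          exact hodd h'
        · simp only [map_add, LinearMap.add_apply]
          rw [show B f f = c' + c' from hc', ← two_mul]
          exact fun h => hodd ((dvd_add_left (dvd_mul_right 2 c')).mp h)
      · -- `a'` even, `c'` odd: swap
        refine ⟨f, e, c', ⟨0, 1, 1, 0, by simp, by simp⟩, ?_, hc, ?_⟩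
        · rw [show B f f = c' + c' from hc', two_mul]
        · rw [hBs.eq]; exact hodd
    · exact ⟨e, f, a', ⟨1, 0, 0, 1, by simp, by simp⟩, by rw [show B e e = a' + a' from ha', two_mul],
        ha, hodd⟩
  -- Step 2: `v = g₁`, `w = 2a g₂ - b g₁`
  obtain ⟨c, hc⟩ := hev g₂
  set b := B g₁ g₂ with hbdef
  have hb' : B g₂ g₁ = b := hBs.eq g₂ g₁
  obtain ⟨c₁, c₂, c₃, c₄, hg₁c, hg₂c⟩ := hg
  refine ⟨g₁, (2 * a) • g₂ - b • g₁, a, b ^ 2 - 4 * a * c,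
    ⟨c₁, c₂, 2 * a * c₃ - b * c₁, 2 * a * c₄ - b * c₂, hg₁c, ?_⟩, ?_, hg₁, ?_, ha, ?_⟩
  · rw [hg₁c, hg₂c]; module
  · simp only [map_sub, map_smul, smul_eq_mul]
    rw [hg₁, ← hbdef]; ring
  · simp only [map_sub, map_smul, LinearMap.sub_apply, LinearMap.smul_apply, smul_eq_mul]
    rw [hg₁, ← hbdef, hb', show B g₂ g₂ = c + c from hc]; ring
  · -- `b` odd: `b = 2s + 1`, `b² - 4ac = 4(s² + s - ac) + 1`
    obtain ⟨s, hs⟩ : ∃ s, b = 2 * s + 1 := by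
      rcases Int.even_or_odd b with h | h
      · exact absurd (even_iff_two_dvd.mp h) hb
      · exact h
    exact ⟨s ^ 2 + s - a * c, by rw [hs]; ring⟩

/-- **`2`-adic block frames** (even form, odd determinant): `n = m + m` is even, and there is an
orthogonal family of integer vectors `v₁, …, v_m, w₁, …, w_m` with `B(v_k,v_k) = 2A_k`, `A_k` odd,
`B(w_k,w_k) = -2A_kD_k`, `D_k ≡ 1 (mod 4)` — the integral shadow of the `2`-adic splitting of an
even unimodular lattice into binary blocks `(2a b; b 2c)`, each diagonalised over `ℚ` as
`⟨2a, -2aD⟩`, `D = b² - 4ac` (Serre, Ch. V §1.3.6; the parity of the rank follows by counting the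
orthogonal vectors). [cite: Serre1973, Ch. V §1.3.6] -/
theorem exists_twoAdicFrame {n : ℕ} {G : Matrix (Fin n) (Fin n) ℤ} (hG : G.IsSymm)
    (hdet : ¬ (2 : ℤ) ∣ G.det) (hev : ∀ x, Even (Matrix.toBilin' G x x)) :
    ∃ m : ℕ, n = m + m ∧ ∃ (v w : Fin m → (Fin n → ℤ)) (A D : Fin m → ℤ),
      (∀ k l, k ≠ l → Matrix.toBilin' G (v k) (v l) = 0 ∧ Matrix.toBilin' G (v k) (w l) = 0 ∧
        Matrix.toBilin' G (w k) (w l) = 0) ∧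
      (∀ k, Matrix.toBilin' G (v k) (w k) = 0) ∧
      ∀ k, Matrix.toBilin' G (v k) (v k) = 2 * A k ∧ Matrix.toBilin' G (w k) (w k) = -(2 * A k * D k) ∧
        ¬ (2 : ℤ) ∣ A k ∧ ∃ t, D k = 4 * t + 1 := by
  -- blocks of size `r₀ = ⌊(n+1)/2⌋`, turned into pairs `(v, w)`
  set r₀ := (n + 1) / 2 with hr₀
  obtain ⟨e, f, hee, hef, hff, hodd⟩ := exists_blockFamily hG hdet hev r₀ (by omega)
  have hblock := fun k => exists_pair_of_block hG hev (e k) (f k) (hodd k)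
  choose v w A D hcomb hvw hvv hww hA hD using hblock
  set B := Matrix.toBilin' G with hB
  have hBs : B.IsSymm := Matrix.isSymm_toBilin'_iff_isSymm.mpr hG
  -- cross-block orthogonality from the combination data
  have hcross : ∀ k l, k ≠ l → ∀ x y : Fin n → ℤ,
      (∃ c₁ c₂ : ℤ, x = c₁ • e k + c₂ • f k) → (∃ c₃ c₄ : ℤ, y = c₃ • e l + c₄ • f l) →
      B x y = 0 := by
    rintro k l hkl x y ⟨c₁, c₂, rfl⟩ ⟨c₃, c₄, rfl⟩
    have hfe : B (f k) (e l) = 0 := by rw [hBs.eq]; exact hef l k hkl.symm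
    simp only [map_add, map_smul, LinearMap.add_apply, LinearMap.smul_apply, smul_eq_mul,
      hee k l hkl, hef k l hkl, hff k l hkl, hfe, mul_zero, add_zero]
  have hvc : ∀ k, ∃ c₁ c₂ : ℤ, v k = c₁ • e k + c₂ • f k := fun k => by
    obtain ⟨c₁, c₂, _, _, h, -⟩ := hcomb k; exact ⟨c₁, c₂, h⟩
  have hwc : ∀ k, ∃ c₃ c₄ : ℤ, w k = c₃ • e k + c₄ • f k := fun k => by
    obtain ⟨_, _, c₃, c₄, -, h⟩ := hcomb k; exact ⟨c₃, c₄, h⟩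
  have hortho : ∀ k l, k ≠ l → B (v k) (v l) = 0 ∧ B (v k) (w l) = 0 ∧ B (w k) (w l) = 0 :=
    fun k l hkl => ⟨hcross k l hkl _ _ (hvc k) (hvc l), hcross k l hkl _ _ (hvc k) (hwc l),
      hcross k l hkl _ _ (hwc k) (hwc l)⟩
  -- nonzero squares, hence `r₀ + r₀ ≤ n`, hence `n = r₀ + r₀`
  have hA0 : ∀ k, A k ≠ 0 := fun k h => hA k (by rw [h]; exact dvd_zero 2)
  have hD0 : ∀ k, D k ≠ 0 := fun k h => by
    obtain ⟨t, ht⟩ := hD k; omega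
  have hvv0 : ∀ k, B (v k) (v k) ≠ 0 := fun k => by
    rw [hvv]; exact mul_ne_zero two_ne_zero (hA0 k)
  have hww0 : ∀ k, B (w k) (w k) ≠ 0 := fun k => by
    rw [hww, neg_ne_zero]; exact mul_ne_zero (mul_ne_zero two_ne_zero (hA0 k)) (hD0 k)
  have hcard : r₀ + r₀ ≤ n := by
    have h := card_le_of_orthogonal G (Sum.elim v w) (fun i j hij => ?_) (fun i => ?_)
    · simpa using h
    · rcases i with i | i <;> rcases j with j | j
      · exact (hortho i j fun h => hij (congrArg Sum.inl h)).1
      · simp only [Sum.elim_inl, Sum.elim_inr]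
        by_cases h : i = j
        · subst h; exact hvw i
        · exact (hortho i j h).2.1
      · simp only [Sum.elim_inl, Sum.elim_inr]
        rw [hBs.eq]
        by_cases h : j = i
        · subst h; exact hvw j
        · exact (hortho j i h).2.1
      · exact (hortho i j fun h => hij (congrArg Sum.inr h)).2.2
    · rcases i with i | i
      · exact hvv0 i
      · exact hww0 i
  refine ⟨r₀, by omega, v, w, A, D, hortho, hvw, fun k => ⟨hvv k, hww k, hA k, hD k⟩⟩

end Literature.NumberTheory.QuadraticForms
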